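import Literature.Probability.RandomPlanarGeometry.BrownianBridgeDecomposition
import Mathlib.MeasureTheory.Measure.Lebesgue.Complex
import HarnessLib

/-!
# The law of the value of the Brownian bridge at a fixed time

For the unit Brownian bridge `β_u = B_u − u B_1` (Kallenberg, *Foundations of Modern
Probability* (2002), Ch. 13: covariance `s(1 − t)`, `s ≤ t`), the value at time `u` is a centred
Gaussian of variance `u(1 − u)`; for the planar unit bridge `η` of `BrownianLoopMeasure` the value
`η_u` is a centred complex Gaussian with independent coordinates of variance `u(1 − u)`, i.e. it
has the density `p_{u(1−u)}(0, ·)` of the planar heat kernel (Lawler, *Conformally Invariant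
Processes in the Plane* (2005), §5.2: the bridge/loop measures `μ(z, w; t) = p_t(z, w) μ^#`
and their Chapman–Kolmogorov relation — the junction point of a loop split at time `u` is
distributed with this Gaussian law).

* `BrownianLoop.variance_bridge₁` — `Var(β_u) = u − u²`;
* `BrownianLoop.map_bridge₁_eval` — `β_u ∼ 𝓝(0, u − u²)`;
* `BrownianLoop.map_unitBridge_eval` — `η_u ∼ (𝓝(0, u−u²) ⊗ 𝓝(0, u−u²)) ∘ (x + iy)⁻¹`;
* `map_gaussianReal_prod_eq_withDensity` — a product of two centred real Gaussians of variance
  `v ≠ 0`, transported to `ℂ`, is Lebesgue measure on `ℂ` with the density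
  `w ↦ pdf_v(Re w) · pdf_v(Im w)` (so `η_u`, and likewise `Z_1` of `map_planarBrownian_one`,
  have explicit planar Gaussian densities).

## References

* O. Kallenberg, *Foundations of Modern Probability* (2nd ed., 2002), Ch. 13.
* G. F. Lawler, *Conformally Invariant Processes in the Plane*, AMS (2005), §5.2.
-/

noncomputable section

open Set MeasureTheory ProbabilityTheory
open scoped unitInterval NNReal ENNReal

namespace Literature.Probability.RandomPlanarGeometry

open Literature.Probability.Process (WienerPair wienerPair brownian measurable_brownian
  preWienerMeasure)

/-! ### A planar Gaussian as a density on `ℂ` -/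

/-- Pushing a measure with density through a measurable equivalence. [folklore] -/
theorem map_withDensity_measurableEquiv {α β : Type*} [MeasurableSpace α] [MeasurableSpace β]
    (μ : Measure α) {f : α → ℝ≥0∞} (hf : Measurable f) (e : α ≃ᵐ β) :
    (μ.withDensity f).map e = (μ.map e).withDensity (f ∘ e.symm) := by
  ext s hs
  rw [e.map_apply, withDensity_apply _ (e.measurable hs), withDensity_apply _ hs,
    Measure.restrict_map e.measurable hs,
    lintegral_map (hf.comp e.symm.measurable) e.measurable]
  refine setLIntegral_congr_fun (e.measurable hs) fun x _ ↦ ?_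
  simp

/-- The map `(x, y) ↦ x + iy` is the inverse of Mathlib's measurable equivalence `ℂ ≃ ℝ × ℝ`.
[folklore] -/
theorem mkComplex_eq_measurableEquivRealProd_symm :
    (fun q : ℝ × ℝ ↦ (q.1 : ℂ) + (q.2 : ℂ) * Complex.I) = Complex.measurableEquivRealProd.symm := by
  funext q
  rw [Complex.measurableEquivRealProd_symm_apply]
  apply Complex.ext <;> simp

/-- **A product of two centred real Gaussians of variance `v ≠ 0`, seen on `ℂ`, is Lebesgue
measure on `ℂ` with density `w ↦ pdf_v(Re w) · pdf_v(Im w)`** (the planar heat kernel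
`p_v(0, w) = (2πv)⁻¹ e^{−|w|²/2v}`). [folklore] -/
theorem map_gaussianReal_prod_eq_withDensity {v : ℝ≥0} (hv : v ≠ 0) :
    ((gaussianReal 0 v).prod (gaussianReal 0 v)).map
        (fun q : ℝ × ℝ ↦ (q.1 : ℂ) + (q.2 : ℂ) * Complex.I) =
      (volume : Measure ℂ).withDensity (fun w ↦ gaussianPDF 0 v w.re * gaussianPDF 0 v w.im) := by
  have hm := measurable_gaussianPDF 0 v
  have h1 : Measurable fun z : ℝ × ℝ ↦ gaussianPDF 0 v z.1 := hm.comp measurable_fst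
  have h2 : Measurable fun z : ℝ × ℝ ↦ gaussianPDF 0 v z.2 := hm.comp measurable_snd
  rw [mkComplex_eq_measurableEquivRealProd_symm, gaussianReal_of_var_ne_zero 0 hv,
    prod_withDensity_left hm, prod_withDensity_right hm, ← withDensity_mul _ h2 h1,
    show ((volume : Measure ℝ).prod (volume : Measure ℝ)) = volume from rfl,
    map_withDensity_measurableEquiv _ (h2.mul h1),
    Complex.volume_preserving_equiv_real_prod.symm.map_eq]
  congr 1
  funext w
  change gaussianPDF 0 v (Complex.measurableEquivRealProd.symm.symm w).2 *
    gaussianPDF 0 v (Complex.measurableEquivRealProd.symm.symm w).1 = _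
  rw [MeasurableEquiv.symm_symm, Complex.measurableEquivRealProd_apply]
  exact mul_comm _ _

namespace BrownianLoop

/-! ### The law of `β_u` and of `η_u` -/

/-- **`Var(β_u) = u − u²`** (Kallenberg (2002), Ch. 13: covariance `s(1 − t)` of the bridge).
[cite: Kallenberg2002, Ch. 13 (Brownian bridge)] -/
theorem variance_bridge₁ (u : I) :
    Var[fun ω ↦ bridge₁ ω u; preWienerMeasure] = (u : ℝ) - (u : ℝ) ^ 2 := by
  rw [← covariance_self (measurable_bridge₁ u).aemeasurable, covariance_bridge₁, min_self]
  ring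

/-- **`β_u ∼ 𝓝(0, u − u²)`**: the value of the unit bridge at time `u` is a centred Gaussian of
variance `u(1 − u)`. [cite: Kallenberg2002, Ch. 13 (Brownian bridge)] -/
theorem map_bridge₁_eval (u : I) :
    preWienerMeasure.map (fun ω ↦ bridge₁ ω u) =
      gaussianReal 0 ((u : ℝ) - (u : ℝ) ^ 2).toNNReal := by
  have h := (isGaussianProcess_bridge₁.hasGaussianLaw_eval u).map_eq_gaussianReal
  rw [h]
  congr 1
  · exact integral_bridge₁ u
  · rw [variance_bridge₁]

/-- **`η_u` is a centred complex Gaussian with independent coordinates of variance `u(1−u)`**: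
its law is the image of `𝓝(0, u−u²) ⊗ 𝓝(0, u−u²)` under `(x, y) ↦ x + iy` (the two
coordinates of the planar bridge are independent real bridges).
[cite: Lawler2005ConformallyInvariant, §5.2] -/
theorem map_unitBridge_eval (u : I) :
    wienerPair.map (fun ω ↦ unitBridge ω u) =
      ((gaussianReal 0 ((u : ℝ) - (u : ℝ) ^ 2).toNNReal).prod
        (gaussianReal 0 ((u : ℝ) - (u : ℝ) ^ 2).toNNReal)).map
        (fun q : ℝ × ℝ ↦ (q.1 : ℂ) + (q.2 : ℂ) * Complex.I) := by
  haveI := isProbabilityMeasure_preWienerMeasure'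
  have hG : Measurable fun q : ℝ × ℝ ↦ (q.1 : ℂ) + (q.2 : ℂ) * Complex.I :=
    (Complex.measurable_ofReal.comp measurable_fst).add
      ((Complex.measurable_ofReal.comp measurable_snd).mul_const _)
  have e2 : (fun ω : WienerPair ↦ unitBridge ω u) =
      (fun q : ℝ × ℝ ↦ (q.1 : ℂ) + (q.2 : ℂ) * Complex.I) ∘
        Prod.map (fun ω₁ ↦ bridge₁ ω₁ u) (fun ω₁ ↦ bridge₁ ω₁ u) := by
    funext ω
    exact unitBridge_eq ω u
  rw [e2, ← Measure.map_map hG ((measurable_bridge₁ u).prodMap (measurable_bridge₁ u)),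
    Process.wienerPair, ← Measure.map_prod_map _ _ (measurable_bridge₁ u) (measurable_bridge₁ u),
    map_bridge₁_eval]

/-- For `u ∈ (0, 1)` the variance `u − u²` is nonzero. [folklore] -/
theorem toNNReal_sub_sq_ne_zero {u : I} (h0 : 0 < (u : ℝ)) (h1 : (u : ℝ) < 1) :
    ((u : ℝ) - (u : ℝ) ^ 2).toNNReal ≠ 0 := by
  have : 0 < (u : ℝ) - (u : ℝ) ^ 2 := by nlinarith
  simpa [Real.toNNReal_eq_zero, not_le] using this

/-- **Density form**: for `u ∈ (0, 1)`, `η_u` has the planar Gaussian density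
`w ↦ pdf_{u−u²}(Re w) pdf_{u−u²}(Im w)` with respect to Lebesgue measure on `ℂ`.
[cite: Lawler2005ConformallyInvariant, §5.2] -/
theorem map_unitBridge_eval_eq_withDensity {u : I} (h0 : 0 < (u : ℝ)) (h1 : (u : ℝ) < 1) :
    wienerPair.map (fun ω ↦ unitBridge ω u) =
      (volume : Measure ℂ).withDensity (fun w ↦
        gaussianPDF 0 ((u : ℝ) - (u : ℝ) ^ 2).toNNReal w.re *
          gaussianPDF 0 ((u : ℝ) - (u : ℝ) ^ 2).toNNReal w.im) := by
  rw [map_unitBridge_eval, map_gaussianReal_prod_eq_withDensity (toNNReal_sub_sq_ne_zero h0 h1)]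

/-- **Density form for the endpoint**: `Z_1` has the standard planar Gaussian density
`w ↦ pdf_1(Re w) pdf_1(Im w) = (2π)⁻¹ e^{−|w|²/2}`. [folklore] -/
theorem map_planarBrownian_one_eq_withDensity :
    wienerPair.map (planarBrownian 1) =
      (volume : Measure ℂ).withDensity (fun w ↦ gaussianPDF 0 1 w.re * gaussianPDF 0 1 w.im) := by
  rw [map_planarBrownian_one, map_gaussianReal_prod_eq_withDensity one_ne_zero]

end BrownianLoop

end Literature.Probability.RandomPlanarGeometry

end
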